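import Literature.MathematicalPhysics.QuantumFieldTheory.Balaban1983to89.Beta.KernelReflection

/-!
# `BalabanUV.Beta.FP.TadpoleFree` — road «FP» for binder row D1, RULING R-FP-46 row **TAD-FREE** (owner, gen 15): THE ONE-POINT FUNCTION OF A
# REFLECTION-COVARIANT, BLOCK-TRANSLATION-COVARIANT ONE-LOOP SYSTEM VANISHES — `tadpole A (V μ y) = 0` for every coarse bond `(μ, y)`

HONEST DEPENDENCY (page 1, mandatory): continuum YM on T⁴ ⇐ BetaPertH ∧ nine spine estimates (0/9 proved); BetaPertH ⇐ (D1) ∧ (D4) ∧ CAP+tail;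
G-an2-4 gates asym, D1 and NE2/3/4.  HONEST FRAMING (cell contract, verbatim): «discharging `BetaPertH` makes Bałaban's UV stability UNCONDITIONAL —
a real constructive-QFT result; it is NOT the continuum limit and NOT the Clay problem.»  THIS MODULE DISCHARGES NOTHING of the wall: it is [folklore]
kernel calculus composed BY NAME from an2's `Beta.KernelReflection` (`refK`, `tadpole_refK`, `bondRefl`) and `Beta.ExpKernelCalculus.tadpole_shiftK`;
GENERIC `D`, fibre, kernels — NOTHING of the road's perfect objects is instantiated (that is row TAD-INST).  No `def`, no `def … : Prop`, nothing cited,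
0 sorry; 0∕4 row-D1 binders; NOT SDF, NOT D1, NOT BetaPertH, NOT continuum, NOT Clay.  «not in print; our bookkeeping».

ABSOLUTE RULE (cell charter, verbatim): «No internally-minted statement may enter as a cited fact. Every hypothesis is either kernel-proved in this package or a
verbatim quotation of a PUBLISHED theorem with page reference. The manuscript(s) under audit are NOT citable for their own disputed steps — they are the thing
under adjudication; programme-internal (2001/route/tribunal) claims are never citable.»

WHY (owner gen 15, located with the model oracle `FP/NestedDressingHessian` ∕ `FP/EffectiveFormJets` and an2's `Beta.StepDefectTadpole` X-an2-54).  Under nested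
dressing (R-FP-45 (B)) the one-loop functionals COMPOSE exactly (`log|det 𝕂_nest| = log|det 𝕂₁| + log|det 𝕂_blk| + c`); the second jets of a composition
`F₁ ∘ U^c_m` are the transported second jets PLUS the first jet of `F₁` contracted with the second response of `U^c_m` (an2's
`StepDefectTadpole.stepDefect_eq_firstJet_secondResponse`).  The END's `RP m` transports `TP 1` by the LINEAR columns `colOf (KPerf m)` only, so the road's step
defect is EXACTLY that cross term: `D m = dF₁ ∘ d²U^c_m`, and (SDF) ⟸ TAD-FREE: the one-point function `b₁ ↦ ½·tadpole (KPerf 1) (vertexOfK (KPerf 1) Lc S∞ b₁)`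
of the literal's perfect one-step system vanishes.  In the genuine theory this is `tr ad = 0`; for the colour-stripped literal it follows from LATTICE SYMMETRY
alone — this file: a resolvent invariant under a leg relabelling `Φ` and a vertex family that is `Φ`-covariant with the REFLECTION SIGN `−1` in its own
direction (`reflSign α α = −1`, the law `hVr` of `KernelReflection.hess_refl` ∕ `axisReflectionCovariant_flip_hessKer`, the same letter that feeds the END's
`hKcov`) and block-translation covariant has one-point function `t ↦ tadpole A (V α y)` both CONSTANT in `y` and ODD under the reflection — hence ZERO.

CONTENTS ([folklore]):
* §1 `tadpole_vertex_translate` — block-translation covariance ⟹ `tadpole A (V μ (y + t)) = tadpole A (V μ y)`.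
* §2 `tadpole_vertex_reflect` — `Φ`-invariant `A`, `Φ`-covariant `V` along the bond map `ρ` with signs `σ` ⟹ `tadpole A (V μ (ρ μ y)) = σ μ · tadpole A (V μ y)`.
* §3 **`tadpole_vertex_eq_zero_of_reflect`** — with `ρ = bondRefl α c`, `σ = reflSign α`: `tadpole A (V α y) = 0` for every `y`;
  **`oneLoopTadpole_eq_zero`** — if every axis `α` admits such a relabelling (the `hAr` shape of `axisReflectionCovariant_flip_hessKer`, first-order part), then
  `tadpole A (V μ y) = 0` for ALL `μ`, `y`: THE ONE-LOOP SYSTEM IS TADPOLE-FREE.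
Provenance: road FP OWNER b2b-balaban-beta-d1-p3 gen 15 (prover-b2b-balaban-beta-d1-p3-g15-0), 2026-08-21; RULING R-FP-46 rows TAD-FREE (this file) ∕ TAD-INST (the literal's
perfect one-step objects; swarm).  Orientation only (nothing quoted is load-bearing): the reflection laws are those of [Balaban1987RG1] (5.7)–(5.8) p. 293 as typed in
`Beta.PolarizationSign` ∕ `Beta.KernelReflection`.
-/

noncomputable section

namespace Summit.QuantumFields.BalabanUV.Beta.FP.TadpoleFree

open Literature.MathematicalPhysics.QuantumFieldTheory.Balaban1983to89.Beta
open ExpKernelCalculus (MKer Decays BiLoc VertexFamily tadpole shiftK tadpole_shiftK)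
open PolarizationSign (reflSign)
open KernelReflection (LegMap refK bondRefl tadpole_refK tadpole_smul)

variable {D : ℕ} {F : Type*} [Fintype F]

/-! ## §1 Block-translation covariance: the one-point function does not depend on the base point -/

/-- [folklore] Under block-translation covariance (`A` invariant under coarse shifts, `V μ (y + t) = shiftK (−N•t) (V μ y)`), the one-point function
`y ↦ tadpole A (V μ y)` is constant. -/
theorem tadpole_vertex_translate {A : MKer D F} {V : Fin D → (Fin D → ℤ) → MKer D F} {N : ℕ}
    (hcovA : ∀ t : Fin D → ℤ, shiftK (-((N : ℤ) • t)) A = A)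
    (hcovV : ∀ (μ : Fin D) (y t : Fin D → ℤ), V μ (y + t) = shiftK (-((N : ℤ) • t)) (V μ y))
    (μ : Fin D) (y t : Fin D → ℤ) : tadpole A (V μ (y + t)) = tadpole A (V μ y) := by
  rw [hcovV]
  conv_lhs => rw [← hcovA t]
  exact tadpole_shiftK _ _ _

/-! ## §2 Reflection covariance: the one-point function picks up the bond sign -/

/-- [folklore] If the resolvent is invariant under the leg relabelling `Φ` and the vertex family at the image bonds `ρ μ y` is the relabelled vertex family
up to the sign `σ μ`, then `tadpole A (V μ (ρ μ y)) = σ μ · tadpole A (V μ y)`. -/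
theorem tadpole_vertex_reflect (Φ : LegMap D F) {A : MKer D F} {V : Fin D → (Fin D → ℤ) → MKer D F} {C Cv δ : ℝ} {N : ℕ}
    (hA : Decays A C δ) (hV : VertexFamily V N Cv δ) (hδ : 0 < δ) (hAr : refK Φ A = A)
    (ρ : Fin D → (Fin D → ℤ) → (Fin D → ℤ)) (σ : Fin D → ℝ) (hVr : ∀ μ y, V μ (ρ μ y) = σ μ • refK Φ (V μ y))
    (μ : Fin D) (y : Fin D → ℤ) : tadpole A (V μ (ρ μ y)) = σ μ * tadpole A (V μ y) := by
  rw [hVr, tadpole_smul]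
  conv_lhs => rw [← hAr]
  rw [tadpole_refK Φ hA (hV μ y) hδ]

/-! ## §3 Tadpole-freeness -/

/-- [folklore] **THE ONE-POINT FUNCTION VANISHES IN THE REFLECTED DIRECTION.**  Block-translation covariant data `(A, V)`, `A` invariant under a leg
relabelling `Φ`, and `V` covariant along the single-axis bond reflection `bondRefl α c` with the printed signs `reflSign α` (the first-order half of the
`hAr` letter of `KernelReflection.axisReflectionCovariant_flip_hessKer`): then `tadpole A (V α y) = 0` for every base point `y` — the one-point function is
constant in `y` (§1) and changes sign under the reflection of its own axis (§2, `reflSign α α = −1`). -/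
theorem tadpole_vertex_eq_zero_of_reflect (Φ : LegMap D F) {A : MKer D F} {V : Fin D → (Fin D → ℤ) → MKer D F} {C Cv δ : ℝ} {N : ℕ}
    (hA : Decays A C δ) (hV : VertexFamily V N Cv δ) (hδ : 0 < δ)
    (hcovA : ∀ t : Fin D → ℤ, shiftK (-((N : ℤ) • t)) A = A)
    (hcovV : ∀ (μ : Fin D) (y t : Fin D → ℤ), V μ (y + t) = shiftK (-((N : ℤ) • t)) (V μ y))
    (hAr : refK Φ A = A) (α : Fin D) (c : ℤ)
    (hVr : ∀ μ y, V μ (bondRefl α c μ y) = reflSign α μ • refK Φ (V μ y)) (y : Fin D → ℤ) :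
    tadpole A (V α y) = 0 := by
  -- constancy in the base point: every value equals the value at `0`
  have hconst : ∀ w : Fin D → ℤ, tadpole A (V α w) = tadpole A (V α 0) := fun w => by
    have h := tadpole_vertex_translate hcovA hcovV α 0 w
    rwa [zero_add] at h
  -- oddness under the reflection of axis `α`
  have hodd := tadpole_vertex_reflect Φ hA hV hδ hAr (bondRefl α c) (reflSign α) hVr α y
  rw [hconst (bondRefl α c α y), hconst y] at hodd
  have hs : reflSign α α = (-1 : ℝ) := by simp [reflSign]
  rw [hs] at hodd
  rw [hconst y]
  linarith

/-- [folklore] **TADPOLE-FREENESS OF A REFLECTION-COVARIANT ONE-LOOP SYSTEM.**  If `(A, V)` is block-translation covariant and for EVERY axis `α` some leg relabelling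
`Φα` leaves `A` invariant and reflects `V` with the printed signs (`∀ μ y, V μ (bondRefl α c μ y) = reflSign α μ • refK Φα (V μ y)`), then the one-point function
vanishes identically: `tadpole A (V μ y) = 0` for all `μ`, `y`.  READING for the road (RULING R-FP-46): with `A := KPerf 1`, `V := vertexOfK (KPerf 1) Lc S∞` (the
literal's perfect one-step system) this is row TAD-FREE, and then the nested step defect `D m = dF₁ ∘ d²U^c_m` (an2's X-an2-54 shape, exact under R-FP-45 (B) by
the model oracle) VANISHES AS A KERNEL. -/
theorem oneLoopTadpole_eq_zero {A : MKer D F} {V : Fin D → (Fin D → ℤ) → MKer D F} {C Cv δ : ℝ} {N : ℕ}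
    (hA : Decays A C δ) (hV : VertexFamily V N Cv δ) (hδ : 0 < δ)
    (hcovA : ∀ t : Fin D → ℤ, shiftK (-((N : ℤ) • t)) A = A)
    (hcovV : ∀ (μ : Fin D) (y t : Fin D → ℤ), V μ (y + t) = shiftK (-((N : ℤ) • t)) (V μ y))
    (hAr : ∀ α : Fin D, ∃ Φα : LegMap D F, refK Φα A = A ∧ ∃ c : ℤ, ∀ μ y, V μ (bondRefl α c μ y) = reflSign α μ • refK Φα (V μ y))
    (μ : Fin D) (y : Fin D → ℤ) : tadpole A (V μ y) = 0 := by
  obtain ⟨Φ, hAr', c, hVr⟩ := hAr μ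
  exact tadpole_vertex_eq_zero_of_reflect Φ hA hV hδ hcovA hcovV hAr' μ c hVr y

end Summit.QuantumFields.BalabanUV.Beta.FP.TadpoleFree

end
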